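import Literature.Probability.RandomPlanarGeometry.ShearModulusAnalyticBeltrami
import Literature.Probability.RandomPlanarGeometry.ConformalMapProofs
import HarnessLib

/-!
# Sheared quadrilaterals: a uniformizing datum of `φ_β R'` from a normalised Beltrami solution

Topic `Literature/Probability/RandomPlanarGeometry`; second of the three files
(`ShearModulusAnalyticBeltrami`, `ShearModulusAnalyticDatum`, `ShearModulusAnalyticProofs`)
reducing the named fact `Literature.Probability.RandomPlanarGeometry.ShearCrossRatioAnalytic`
(`ShearModulusAnalytic.lean`) to the Ahlfors–Bers theorem. Everything here is PROVED; no
definition is introduced. ONE shear `φ_β`, `im β > 0`, and ONE uniformizing datum `(f', x')` of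
the conformal rectangle `R'`: suppose `W` is a self-map of the closed upper half-plane with
inverse `V`, mapping `ℍₒ` to `ℍₒ`, real and increasing on `ℝ`, real-differentiable on `ℍₒ` and
solving there, classically and with `W_z ≠ 0`, the Beltrami equation whose coefficient is that
of the quasiconformal map `φ_β ∘ f'`, namely `ν(β) \overline{f′'}/f′'`,
`ν(β) = (1 + iβ)/(1 - iβ)` — i.e. `W` is the normalised solution `w^μ` of Ahlfors–Bers for this
coefficient (reflected in `ℝ`). Then:

* `hasDerivAt_shear_comp_inverse` — `φ_β ∘ f' ∘ V` is complex-differentiable on `ℍₒ` with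
  non-vanishing derivative (Ahlfors–Bers 1960, Thm. 5 (vii): a `μ`-conformal map composed with
  the inverse of the normalised `μ`-conformal homeomorphism is analytic; here through the
  pointwise lemma `hasDerivAt_comp_localInverse_of_beltrami`);
* `tendsto_inverse_nhdsWithin` — `V → x` within `ℍₒ` at the boundary point `W x`, `x ∈ ℝ`;
* `exists_isUniformizing_shear` — for EVERY presentation `R` of the sheared quad
  (`R.carrier = φ_β '' R'.carrier`, `R.pt i = φ_β (R'.pt i)`), `φ_β ∘ f' ∘ V : ℍₒ → R` is a
  conformal equivalence (inverse `W ∘ f'⁻¹ ∘ φ_β⁻¹`) with boundary value `R.pt i` at the real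
  point `W (x' i)`; so `(φ_β ∘ f' ∘ V, W ∘ x')` is a uniformizing datum of `φ_β R'` and its
  modulus is `crossRatio (W ∘ x')`.

The third file feeds in the Ahlfors–Bers solutions `W = W_α` for `α` near `α₀` and reads off the
analyticity of `α ↦ crossRatio (W_α ∘ x')`.

## References

* L. V. Ahlfors, L. Bers, *Riemann's mapping theorem for variable metrics*, Ann. of Math. (2) 72
  (1960), 385–404, Thm. 5 (vii), Thm. 6. [AhlforsBers1960]
* V. Beffara, *Is critical 2D percolation universal?*, Progr. Probab. 60 (2008), §1.1, §2.1.
  [Beffara2008Universal]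
-/

noncomputable section

open Set Filter Complex
open scoped Topology ComplexConjugate
open UpperHalfPlane (upperHalfPlaneSet isOpen_upperHalfPlaneSet)

namespace Literature.Probability.RandomPlanarGeometry

open Literature.Barriers.CriticalPhenomena (moduliShear moduliShear_eq_hol_add_antihol
  shearHomeomorph coe_shearHomeomorph continuous_moduliShear)

/-! ### One shear: from a normalised Beltrami solution to a uniformizing datum -/

section OneShear

variable {R' : ConformalRectangle} {f' : ConformalEquiv upperHalfPlaneSet R'.carrier}
  {β : ℂ} {W V : ℂ → ℂ}

/-- **Conformality of `φ_β ∘ f' ∘ W⁻¹`.** If `W` solves, classically on `ℍₒ`, the Beltrami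
equation with the coefficient `ν(β) \overline{f′'}/f′'` of the quasiconformal map `φ_β ∘ f'`
(`W_z ≠ 0`), and `V` is a continuous inverse of `W` on `ℍₒ`, then `φ_β ∘ f' ∘ V` is
complex-differentiable on `ℍₒ` with non-vanishing derivative (Ahlfors–Bers 1960, Thm. 5 (vii)).
[cite: AhlforsBers1960, Thm. 5 (vii)] -/
theorem hasDerivAt_shear_comp_inverse (hβ : 0 < β.im)
    (hVmaps : MapsTo V upperHalfPlaneSet upperHalfPlaneSet)
    (hWV : ∀ z ∈ upperHalfPlaneSet, W (V z) = z)
    (hVcont : ContinuousOn V upperHalfPlaneSet)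
    (hdiff : DifferentiableOn ℝ W upperHalfPlaneSet)
    (hbel : ∀ z ∈ upperHalfPlaneSet,
      fderiv ℝ W z 1 - I * fderiv ℝ W z I ≠ 0 ∧
      fderiv ℝ W z 1 + I * fderiv ℝ W z I =
        (1 + I * β) / (1 - I * β) * (conj (deriv f' z) / deriv f' z) *
          (fderiv ℝ W z 1 - I * fderiv ℝ W z I))
    {z : ℂ} (hz : z ∈ upperHalfPlaneSet) :
    ∃ c : ℂ, c ≠ 0 ∧ HasDerivAt (fun z => moduliShear β (f' (V z))) c z := by
  have hw : V z ∈ upperHalfPlaneSet := hVmaps hz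
  set w := V z with hwdef
  have hW : HasFDerivAt W (fderiv ℝ W w) w :=
    hdiff.hasFDerivAt (isOpen_upperHalfPlaneSet.mem_nhds hw)
  have hcf : deriv f' w ≠ 0 := ConformalEquiv.deriv_ne_zero_holds f' isOpen_upperHalfPlaneSet hw
  have hf'd : HasDerivAt f' (deriv f' w) w :=
    ((f'.differentiableOn w hw).differentiableAt
      (isOpen_upperHalfPlaneSet.mem_nhds hw)).hasDerivAt
  obtain ⟨B, hG, hB1, hB2⟩ := exists_hasFDerivAt_moduliShear_comp β hf'd
  obtain ⟨ha, hA⟩ := hbel w hw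
  have h1 : 1 - I * β ≠ 0 := one_sub_I_mul_ne_zero hβ
  have hm : ‖(1 + I * β) / (1 - I * β) * (conj (deriv f' w) / deriv f' w)‖ < 1 := by
    rw [norm_mul, norm_div (conj _), Complex.norm_conj, div_self (norm_ne_zero_iff.2 hcf), mul_one]
    exact norm_shearBeltrami_lt_one hβ
  have hB : B 1 + I * B I =
      (1 + I * β) / (1 - I * β) * (conj (deriv f' w) / deriv f' w) * (B 1 - I * B I) := by
    rw [hB1, hB2]
    field_simp
  have hV : ContinuousAt V z := hVcont.continuousAt (isOpen_upperHalfPlaneSet.mem_nhds hz)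
  have hWV' : ∀ᶠ y in 𝓝 z, W (V y) = y :=
    Filter.eventually_of_mem (isOpen_upperHalfPlaneSet.mem_nhds hz) hWV
  have key := hasDerivAt_comp_localInverse_of_beltrami (G := fun y => moduliShear β (f' y))
    hW hG hm ha hA hB hwdef.symm hV hWV'
  refine ⟨_, div_ne_zero ?_ ha, key⟩
  rw [hB1]
  exact mul_ne_zero h1 hcf

/-- Boundary behaviour of the inverse: if `V` is continuous on the closed half-plane, inverse to
`W` there, and maps `ℍₒ` into `ℍₒ`, then `V → x` within `ℍₒ` as `z → W x` within `ℍₒ`, for real `x`.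
[folklore] -/
theorem tendsto_inverse_nhdsWithin (hVmaps : MapsTo V upperHalfPlaneSet upperHalfPlaneSet)
    (hinv : ∀ z : ℂ, 0 ≤ z.im → V (W z) = z ∧ W (V z) = z)
    (hVcont : ContinuousOn V {z : ℂ | 0 ≤ z.im}) (hreal : ∀ x : ℝ, (W x).im = 0) (x : ℝ) :
    Tendsto V (𝓝[upperHalfPlaneSet] (W x)) (𝓝[upperHalfPlaneSet] x) := by
  have hx : (0 : ℝ) ≤ (x : ℂ).im := by simp
  have h1 : ContinuousWithinAt V {z : ℂ | 0 ≤ z.im} (W x) := hVcont _ (by simp [hreal x])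
  have h2 : Tendsto V (𝓝[upperHalfPlaneSet] (W x)) (𝓝 (x : ℂ)) := by
    have h := h1.tendsto
    rw [(hinv x hx).1] at h
    exact h.mono_left (nhdsWithin_mono _ fun z (hz : 0 < z.im) => hz.le)
  exact tendsto_nhdsWithin_iff.2 ⟨h2, eventually_mem_nhdsWithin.mono fun z hz => hVmaps hz⟩

/-- **From a normalised Beltrami solution to a uniformizing datum of the sheared rectangle.**
Let `(f', x')` uniformize `R'`, `0 < im β`, and let `W` (inverse `V`) be a self-map of the closed
upper half-plane mapping `ℍₒ` to `ℍₒ`, real and increasing on `ℝ`, real-differentiable on `ℍₒ`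
and solving there the Beltrami equation with the coefficient `ν(β) \overline{f′'}/f′'` of
`φ_β ∘ f'`, `W_z ≠ 0` (the normalised solution of Ahlfors–Bers). Then for every presentation `R`
of the sheared quad `φ_β R'`, `φ_β ∘ f' ∘ V : ℍₒ → R` is a conformal equivalence with boundary
values `R.pt i` at the real points `W (x' i)`: `(φ_β ∘ f' ∘ V, W ∘ x')` uniformizes `φ_β R'`
(Ahlfors–Bers 1960, Thm. 5 (vii) for the conformality; boundary correspondence by continuity of
`V` on the closed half-plane). [cite: AhlforsBers1960, Thm. 5 (vii)] -/
theorem exists_isUniformizing_shear {x' : Fin 4 → ℝ} (hβ : 0 < β.im)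
    (hux' : R'.IsUniformizing f' x')
    (hWmaps : MapsTo W upperHalfPlaneSet upperHalfPlaneSet)
    (hVmaps : MapsTo V upperHalfPlaneSet upperHalfPlaneSet)
    (hinv : ∀ z : ℂ, 0 ≤ z.im → V (W z) = z ∧ W (V z) = z)
    (hVcont : ContinuousOn V {z : ℂ | 0 ≤ z.im})
    (hreal : ∀ x : ℝ, (W x).im = 0) (hmono : StrictMono fun x : ℝ => (W x).re)
    (hdiff : DifferentiableOn ℝ W upperHalfPlaneSet)
    (hbel : ∀ z ∈ upperHalfPlaneSet,
      fderiv ℝ W z 1 - I * fderiv ℝ W z I ≠ 0 ∧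
      fderiv ℝ W z 1 + I * fderiv ℝ W z I =
        (1 + I * β) / (1 - I * β) * (conj (deriv f' z) / deriv f' z) *
          (fderiv ℝ W z 1 - I * fderiv ℝ W z I))
    (R : ConformalRectangle) (hc : R.carrier = moduliShear β '' R'.carrier)
    (hp : ∀ i, R.pt i = moduliShear β (R'.pt i)) :
    ∃ F : ConformalEquiv upperHalfPlaneSet R.carrier,
      R.IsUniformizing F fun i => (W (x' i)).re := by
  have hβ' : β.im ≠ 0 := hβ.ne'
  set sh := shearHomeomorph β hβ' with hsh
  have hsh_apply : ∀ u, sh u = moduliShear β u := fun u => rfl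
  have hsh_symm : ∀ u, sh.symm (moduliShear β u) = u := fun u => by
    rw [← hsh_apply, Homeomorph.symm_apply_apply]
  have hWV : ∀ z ∈ upperHalfPlaneSet, W (V z) = z := fun z hz => (hinv z (le_of_lt hz)).2
  have hVW : ∀ z ∈ upperHalfPlaneSet, V (W z) = z := fun z hz => (hinv z (le_of_lt hz)).1
  have hVcont' : ContinuousOn V upperHalfPlaneSet := hVcont.mono fun z (hz : 0 < z.im) => hz.le
  -- the maps
  have hmap_source : ∀ z ∈ upperHalfPlaneSet, moduliShear β (f' (V z)) ∈ R.carrier := by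
    intro z hz
    rw [hc]
    exact mem_image_of_mem _ (f'.mapsTo (hVmaps hz))
  have hmap_target : ∀ w ∈ R.carrier, W (f'.symm (sh.symm w)) ∈ upperHalfPlaneSet := by
    intro w hw
    rw [hc] at hw
    obtain ⟨u, hu, rfl⟩ := hw
    rw [hsh_symm]
    exact hWmaps (f'.symm_mapsTo hu)
  have hleft : ∀ z ∈ upperHalfPlaneSet, W (f'.symm (sh.symm (moduliShear β (f' (V z))))) = z := by
    intro z hz
    rw [hsh_symm, f'.symm_apply_apply (hVmaps hz), hWV z hz]
  have hright : ∀ w ∈ R.carrier, moduliShear β (f' (V (W (f'.symm (sh.symm w))))) = w := by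
    intro w hw
    rw [hc] at hw
    obtain ⟨u, hu, rfl⟩ := hw
    rw [hsh_symm, hVW _ (f'.symm_mapsTo hu), f'.apply_symm_apply hu]
  have hderiv := fun z (hz : z ∈ upperHalfPlaneSet) =>
    hasDerivAt_shear_comp_inverse hβ hVmaps hWV hVcont' hdiff hbel hz
  have hdiffOn : DifferentiableOn ℂ (fun z => moduliShear β (f' (V z))) upperHalfPlaneSet := by
    intro z hz
    obtain ⟨c, -, hd⟩ := hderiv z hz
    exact hd.differentiableAt.differentiableWithinAt
  have hdiffOn_symm : DifferentiableOn ℂ (fun w => W (f'.symm (sh.symm w))) R.carrier := by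
    intro w hw
    have hw' : sh.symm w ∈ R'.carrier := by
      rw [hc] at hw
      obtain ⟨u, hu, rfl⟩ := hw
      rwa [hsh_symm]
    obtain ⟨c, hc0, hd⟩ := hderiv _ (hmap_target w hw)
    have hcont : ContinuousAt (fun w => W (f'.symm (sh.symm w))) w := by
      have h1 : ContinuousAt sh.symm w := sh.symm.continuous.continuousAt
      have h2 : ContinuousAt f'.symm (sh.symm w) :=
        f'.symm.continuousOn.continuousAt (R'.isOpen.mem_nhds hw')
      have h3 : ContinuousAt W (f'.symm (sh.symm w)) :=
        hdiff.continuousOn.continuousAt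
          (isOpen_upperHalfPlaneSet.mem_nhds (f'.symm_mapsTo hw'))
      have h23 : ContinuousAt (fun w => f'.symm (sh.symm w)) w := ContinuousAt.comp (g := f'.symm) h2 h1
      exact ContinuousAt.comp (g := W) h3 h23
    have hev : ∀ᶠ y in 𝓝 w, moduliShear β (f' (V (W (f'.symm (sh.symm y))))) = y :=
      Filter.eventually_of_mem (R.isOpen.mem_nhds hw) hright
    exact (hd.of_local_left_inverse hcont hc0 hev).differentiableAt.differentiableWithinAt
  let F : ConformalEquiv upperHalfPlaneSet R.carrier :=
    { toFun := fun z => moduliShear β (f' (V z))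
      invFun := fun w => W (f'.symm (sh.symm w))
      source := upperHalfPlaneSet
      target := R.carrier
      map_source' := hmap_source
      map_target' := hmap_target
      left_inv' := hleft
      right_inv' := hright
      source_eq := rfl
      target_eq := rfl
      differentiableOn := hdiffOn
      differentiableOn_symm := hdiffOn_symm }
  refine ⟨F, hux'.1.imp (fun h => hmono.comp h) (fun h => hmono.comp_strictAnti h), fun i => ?_⟩
  -- boundary values
  have hyi : (((W (x' i)).re : ℝ) : ℂ) = W (x' i) :=
    Complex.ext (by simp) (by simp [hreal (x' i)])
  show Tendsto (fun z => moduliShear β (f' (V z))) (𝓝[upperHalfPlaneSet] (((W (x' i)).re : ℝ) : ℂ))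
    (𝓝 (R.pt i))
  rw [hyi, hp i]
  have hV := tendsto_inverse_nhdsWithin hVmaps hinv hVcont hreal (x' i)
  have hf : Tendsto f' (𝓝[upperHalfPlaneSet] ((x' i : ℝ) : ℂ)) (𝓝 (R'.pt i)) := hux'.2 i
  exact ((continuous_moduliShear β).tendsto _).comp (hf.comp hV)

end OneShear

end Literature.Probability.RandomPlanarGeometry
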